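import Mathlib
import HarnessLib
import Literature.MathematicalPhysics.QuantumLattice.HubbardSectorPropagatorGram
import Summits.HubbardSuperconductivity.HubbardSuperconductivity.Theorems.KLProgrammeKLRegimeWickCrossContractionOverlap
import Summits.HubbardSuperconductivity.HubbardSuperconductivity.Theorems.KLProgrammeH10TwoPointLimitFrameSectorOverlap

/-!
# Route `KLProgramme` — ENGINE child (stmt-HubbardSuperconductivity-19918), `stub_engine_step_values` (E2-v9), E2-WICK-ROADMAP §5 (iv):
# the `k + 1`-line two-vertex term for SECTORISED NORMAL COVARIANCES `S(F)ᵀ·C_p·S(F)` — the overlap structure is the family's own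

Cell gate-hubbard-kl, seat p5 (g4).  Sequel of …WickCrossContractionOverlap.  For the lines of the single-scale step — pulled-back normal charged
covariances `C′_i = S(F)ᵀ·normalCovariance p_i·S(F)` (`HubbardSectorPropagatorGram`; the slice `C^K_{(Λ,Λ′]}` at zero seed, its `t`-derivative, the
soft covariance … are all of this form, with ONE sector family `F` and different symbols `p_i`) — the support-overlap hypothesis of
`sum_norm_kernel_crossContract_le_of_overlap` is automatic: by the closed form `sectorSub_pullback_normalCovariance_apply` the entry
`C′(Y,Y′)` is a sum over momenta `k` of terms containing the factor `F_{ω_Y}(k)·F_{ω_{Y′}}(k)`, so it vanishes unless the two multipliers have a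
common support point.  Hence, with `ovlF ω ω′ :⇔ ∃ k, F_ω(k)·F_{ω′}(k) ≠ 0` (at most `ρ₀` partners per `ω`; fat family: `ρ₀ = 9`,
`…FatOverlapCount.card_overlap_bgmFat_le_nine`) and the `4` spin/charge values of a `SectorLeg`:

* `pullback_normalCovariance_eq_zero_of_forall_mul_eq_zero` — disjoint supports ⇒ zero entry;
* `card_filter_sectorLeg_le` — `#{τ : SectorLeg N | P τ.sector} ≤ 4·#{ω | P ω}`;
* **`sum_norm_kernel_crossContract_pullback_le`** / **`…_of_eq_one`** — `k + 1` symbols `p_0, …, p_k`, one family `F`: row/column sums of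
  `‖C′_0‖` at most `α`, entries `‖C′_i(Y,Y′)‖ ≤ δ_i` (`i ≥ 1`) ⇒
  `Σ_{Z : Z p = z} ‖kernel ((Δ_×(C′_k)∘⋯∘Δ_×(C′_0))(a⁰·b¹)) m (Z,s)‖ ≤ ((k+1+m₀)!(k+1+m₁)!/m!) · (α · ∏_i (δ_i · 4ρ₀) · Na · Nb)`;
* **`sum_norm_kernel_crossLaplacian_pow_pullback_le`** / **`…_of_eq_one`** — one symbol on all lines: `… ≤ ((k+1+m₀)!(k+1+m₁)!/m!)·(α·(4δρ₀)^k·Na·Nb)`.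

What remains abstract is exactly what the engine supplies per scale: `α = α_n` (…SectorSliceAlphaFat `rowSum_norm_pullback_sliceCT_le_alpha`),
`δ = κ_n²` (…SectorSliceGramFat `norm_entry_sliceCT_bgmFat_le`), and the kernel norms `Na`, `Nb` of the two vertices (the engine's invariants
`KernelNormsV4` / `KernelNormsLevels`).  Pure bookkeeping; no definitions, no named facts.  References (locators only): Feldman–Knörrer–Trubowitz,
Rev. Math. Phys. 15 (2003) Prop. XII; Benfatto–Giuliani–Mastropietro, Ann. Henri Poincaré 7 (2006) §2.7 (2.66), (2.71a), §2.8 (2.80)–(2.83).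
-/

noncomputable section

namespace Summit.HubbardSuperconductivity.HubbardSuperconductivity.Theorems.KLRegimeWick

set_option linter.dupNamespace false -- summit = problem name (single-conjunct summit), D-0017

open Literature.MathematicalPhysics.QuantumLattice Literature.Probability.LatticeModels GrassmannAlgebra Finset Matrix
open scoped ComplexConjugate

section Sector

variable {L M N : ℕ} [NeZero L]

/-- **Disjoint supports give a zero sectorised propagator**: if `F_{ω_Y}(k)·F_{ω_{Y′}}(k) = 0` for every `k` then
`(S(F)ᵀ·C_p·S(F))(Y,Y′) = 0`. -/
theorem pullback_normalCovariance_eq_zero_of_forall_mul_eq_zero (β : ℝ) (F : Fin N → FreqMomentum L M → ℂ)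
    (p : FreqMomentum L M × Fin 2 → ℂ) {Y Y' : SpaceTimeIdx L M × SectorLeg N} (h : ∀ k, F Y.2.1.1 k * F Y'.2.1.1 k = 0) :
    ((sectorSubMatrix L M β F).transpose * normalCovariance L M p * sectorSubMatrix L M β F) Y Y' = 0 := by
  rw [sectorSub_pullback_normalCovariance_apply]
  by_cases hσ : Y.2.1.2 = Y'.2.1.2
  · rw [if_pos hσ]
    refine sum_eq_zero fun k _ => ?_
    rcases mul_eq_zero.1 (h k) with h0 | h0
    · simp [h0]
    · simp [h0]
  · rw [if_neg hσ]

/-- The overlap relation `∃ k, F_ω(k)·F_{ω′}(k) ≠ 0` read on sector legs: a nonzero sectorised propagator forces it. -/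
theorem exists_mul_ne_zero_of_pullback_normalCovariance_ne_zero (β : ℝ) (F : Fin N → FreqMomentum L M → ℂ)
    (p : FreqMomentum L M × Fin 2 → ℂ) {Y Y' : SpaceTimeIdx L M × SectorLeg N}
    (h : ((sectorSubMatrix L M β F).transpose * normalCovariance L M p * sectorSubMatrix L M β F) Y Y' ≠ 0) :
    ∃ k, F Y.2.1.1 k * F Y'.2.1.1 k ≠ 0 := by
  by_contra hk
  exact h (pullback_normalCovariance_eq_zero_of_forall_mul_eq_zero β F p fun k => by
    by_contra hk'
    exact hk ⟨k, hk'⟩)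

omit [NeZero L] in
/-- Counting sector legs through their sector index: `#{τ : SectorLeg N | P τ.sector} ≤ 4 · #{ω | P ω}` (two spins, two charges). -/
theorem card_filter_sectorLeg_le (P : Fin N → Prop) [DecidablePred P] :
    ((univ : Finset (SectorLeg N)).filter fun τ => P τ.1.1).card ≤ 4 * ((univ : Finset (Fin N)).filter P).card := by
  classical
  have h : (univ : Finset (SectorLeg N)).filter (fun τ => P τ.1.1) =
      (((univ : Finset (Fin N)).filter P) ×ˢ (univ : Finset (Fin 2))) ×ˢ (univ : Finset (Fin 2)) := by
    ext τ
    simp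
  rw [h, card_product, card_product, card_univ, Fintype.card_fin]
  omega

/-- **The `k + 1`-line two-vertex term for sectorised normal covariances, pinned at a free leg of `a`.**  One sector family `F` with at most
`ρ₀` overlap partners per multiplier, symbols `p_0, …, p_k`; line `0` with row/column sums of `‖C′_0‖` at most `α`, lines `i ≥ 1` with entries at
most `δ_i`; `a`, `b`, `s`, `p` as in `sum_norm_kernel_crossContract_le`.  Bound: `((k+1+m₀)!(k+1+m₁)!/m!)·(α·∏_i(δ_i·(4ρ₀))·Na·Nb)`. -/
theorem sum_norm_kernel_crossContract_pullback_le {k m m₀ m₁ : ℕ} (β : ℝ) (F : Fin N → FreqMomentum L M → ℂ) {ρ₀ : ℕ}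
    (hρ₀ : ∀ ω : Fin N, ((univ : Finset (Fin N)).filter fun ω' => ∃ q, F ω q * F ω' q ≠ 0).card ≤ ρ₀)
    (sym : Fin (k + 1) → FreqMomentum L M × Fin 2 → ℂ)
    (a b : GrassmannAlgebra ℂ (SpaceTimeIdx L M × SectorLeg N)) (s : Fin m → Fin 2)
    (hm₀ : (univ.filter fun i => s i = 0).card = m₀) (hm₁ : (univ.filter fun i => s i = 1).card = m₁) (p : Fin m) (hp : s p = 0)
    (z : SpaceTimeIdx L M × SectorLeg N) {α : ℝ}
    (hrow : ∀ X, ∑ Y, ‖((sectorSubMatrix L M β F).transpose * normalCovariance L M (sym 0) * sectorSubMatrix L M β F) X Y‖ ≤ α)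
    (hcol : ∀ Y, ∑ X, ‖((sectorSubMatrix L M β F).transpose * normalCovariance L M (sym 0) * sectorSubMatrix L M β F) X Y‖ ≤ α)
    (δ : Fin k → ℝ) (hδ : ∀ i, 0 ≤ δ i)
    (hent : ∀ (i : Fin k) X Y,
      ‖((sectorSubMatrix L M β F).transpose * normalCovariance L M (sym i.succ) * sectorSubMatrix L M β F) X Y‖ ≤ δ i)
    {Na Nb : ℝ} (hNb0 : 0 ≤ Nb)
    (hNa : ∀ p₀ : Fin m₀, ∑ X : Fin (k + 1) → SpaceTimeIdx L M × SectorLeg N,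
      ∑ X₀ ∈ univ.filter (fun X₀ : Fin m₀ → SpaceTimeIdx L M × SectorLeg N => X₀ p₀ = z),
        ‖kernel ℂ a (k + 1 + m₀) (Fin.append X X₀)‖ ≤ Na)
    (hNb : ∀ (Y₀ : SpaceTimeIdx L M × SectorLeg N) (τ : Fin k → SectorLeg N), ∑ y : Fin k → SpaceTimeIdx L M,
      ∑ Y₁ : Fin m₁ → SpaceTimeIdx L M × SectorLeg N,
        ‖kernel ℂ b (k + 1 + m₁) (Fin.append (Fin.cons Y₀ (fun i => (y i, τ i)) : Fin (k + 1) → SpaceTimeIdx L M × SectorLeg N) Y₁)‖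
          ≤ Nb) :
    ∑ Z ∈ univ.filter (fun Z : Fin m → SpaceTimeIdx L M × SectorLeg N => Z p = z),
        ‖kernel ℂ (((List.ofFn fun i => grassmannLaplacian ℂ (crossCov ℂ
            ((sectorSubMatrix L M β F).transpose * normalCovariance L M (sym i) * sectorSubMatrix L M β F))).reverse).prod
          (dblCopy ℂ 0 a * dblCopy ℂ 1 b)) m (fun i => (Z i, s i))‖ ≤
      (((k + 1 + m₀).factorial * (k + 1 + m₁).factorial : ℝ) / m.factorial) * (α * (∏ i, δ i * ((4 * ρ₀ : ℕ) : ℝ)) * Na * Nb) := by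
  classical
  refine sum_norm_kernel_crossContract_le_of_overlap
    (fun i => (sectorSubMatrix L M β F).transpose * normalCovariance L M (sym i) * sectorSubMatrix L M β F) a b s hm₀ hm₁ p hp z
    hrow hcol (fun σ τ : SectorLeg N => ∃ q, F σ.1.1 q * F τ.1.1 q ≠ 0) (fun σ τ ⟨q, hq⟩ => ⟨q, by rwa [mul_comm] at hq⟩)
    (fun σ => ?_) δ hδ hent (fun i X Y hXY => exists_mul_ne_zero_of_pullback_normalCovariance_ne_zero β F (sym i.succ) hXY)
    hNb0 hNa hNb
  exact (card_filter_sectorLeg_le fun ω' => ∃ q, F σ.1.1 q * F ω' q ≠ 0).trans (Nat.mul_le_mul_left 4 (hρ₀ σ.1.1))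

/-- **The same, pinned at a free leg of `b`.** -/
theorem sum_norm_kernel_crossContract_pullback_le_of_eq_one {k m m₀ m₁ : ℕ} (β : ℝ) (F : Fin N → FreqMomentum L M → ℂ) {ρ₀ : ℕ}
    (hρ₀ : ∀ ω : Fin N, ((univ : Finset (Fin N)).filter fun ω' => ∃ q, F ω q * F ω' q ≠ 0).card ≤ ρ₀)
    (sym : Fin (k + 1) → FreqMomentum L M × Fin 2 → ℂ)
    (a b : GrassmannAlgebra ℂ (SpaceTimeIdx L M × SectorLeg N)) (s : Fin m → Fin 2)
    (hm₀ : (univ.filter fun i => s i = 0).card = m₀) (hm₁ : (univ.filter fun i => s i = 1).card = m₁) (p : Fin m) (hp : s p = 1)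
    (z : SpaceTimeIdx L M × SectorLeg N) {α : ℝ}
    (hrow : ∀ X, ∑ Y, ‖((sectorSubMatrix L M β F).transpose * normalCovariance L M (sym 0) * sectorSubMatrix L M β F) X Y‖ ≤ α)
    (hcol : ∀ Y, ∑ X, ‖((sectorSubMatrix L M β F).transpose * normalCovariance L M (sym 0) * sectorSubMatrix L M β F) X Y‖ ≤ α)
    (δ : Fin k → ℝ) (hδ : ∀ i, 0 ≤ δ i)
    (hent : ∀ (i : Fin k) X Y,
      ‖((sectorSubMatrix L M β F).transpose * normalCovariance L M (sym i.succ) * sectorSubMatrix L M β F) X Y‖ ≤ δ i)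
    {Na Nb : ℝ} (hNa0 : 0 ≤ Na)
    (hNa : ∀ (X₀ : SpaceTimeIdx L M × SectorLeg N) (σ : Fin k → SectorLeg N), ∑ x : Fin k → SpaceTimeIdx L M,
      ∑ Z₀ : Fin m₀ → SpaceTimeIdx L M × SectorLeg N,
        ‖kernel ℂ a (k + 1 + m₀) (Fin.append (Fin.cons X₀ (fun i => (x i, σ i)) : Fin (k + 1) → SpaceTimeIdx L M × SectorLeg N) Z₀)‖
          ≤ Na)
    (hNb : ∀ p₁ : Fin m₁, ∑ Y : Fin (k + 1) → SpaceTimeIdx L M × SectorLeg N,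
      ∑ Y₁ ∈ univ.filter (fun Y₁ : Fin m₁ → SpaceTimeIdx L M × SectorLeg N => Y₁ p₁ = z),
        ‖kernel ℂ b (k + 1 + m₁) (Fin.append Y Y₁)‖ ≤ Nb) :
    ∑ Z ∈ univ.filter (fun Z : Fin m → SpaceTimeIdx L M × SectorLeg N => Z p = z),
        ‖kernel ℂ (((List.ofFn fun i => grassmannLaplacian ℂ (crossCov ℂ
            ((sectorSubMatrix L M β F).transpose * normalCovariance L M (sym i) * sectorSubMatrix L M β F))).reverse).prod
          (dblCopy ℂ 0 a * dblCopy ℂ 1 b)) m (fun i => (Z i, s i))‖ ≤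
      (((k + 1 + m₀).factorial * (k + 1 + m₁).factorial : ℝ) / m.factorial) * (α * (∏ i, δ i * ((4 * ρ₀ : ℕ) : ℝ)) * Na * Nb) := by
  classical
  refine sum_norm_kernel_crossContract_le_of_overlap_of_eq_one
    (fun i => (sectorSubMatrix L M β F).transpose * normalCovariance L M (sym i) * sectorSubMatrix L M β F) a b s hm₀ hm₁ p hp z
    hrow hcol (fun σ τ : SectorLeg N => ∃ q, F σ.1.1 q * F τ.1.1 q ≠ 0) (fun σ τ ⟨q, hq⟩ => ⟨q, by rwa [mul_comm] at hq⟩)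
    (fun σ => ?_) δ hδ hent (fun i X Y hXY => exists_mul_ne_zero_of_pullback_normalCovariance_ne_zero β F (sym i.succ) hXY)
    hNa0 hNa hNb
  exact (card_filter_sectorLeg_le fun ω' => ∃ q, F σ.1.1 q * F ω' q ≠ 0).trans (Nat.mul_le_mul_left 4 (hρ₀ σ.1.1))

/-- **One symbol on all lines** (the `(k+1)`-st power of `Δ_×(S(F)ᵀ·C_p·S(F))`), pinned at a free leg of `a`:
`… ≤ ((k+1+m₀)!(k+1+m₁)!/m!) · (α · (δ·(4ρ₀))^k · Na · Nb)`. -/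
theorem sum_norm_kernel_crossLaplacian_pow_pullback_le {k m m₀ m₁ : ℕ} (β : ℝ) (F : Fin N → FreqMomentum L M → ℂ) {ρ₀ : ℕ}
    (hρ₀ : ∀ ω : Fin N, ((univ : Finset (Fin N)).filter fun ω' => ∃ q, F ω q * F ω' q ≠ 0).card ≤ ρ₀)
    (sym : FreqMomentum L M × Fin 2 → ℂ)
    (a b : GrassmannAlgebra ℂ (SpaceTimeIdx L M × SectorLeg N)) (s : Fin m → Fin 2)
    (hm₀ : (univ.filter fun i => s i = 0).card = m₀) (hm₁ : (univ.filter fun i => s i = 1).card = m₁) (p : Fin m) (hp : s p = 0)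
    (z : SpaceTimeIdx L M × SectorLeg N) {α : ℝ}
    (hrow : ∀ X, ∑ Y, ‖((sectorSubMatrix L M β F).transpose * normalCovariance L M sym * sectorSubMatrix L M β F) X Y‖ ≤ α)
    (hcol : ∀ Y, ∑ X, ‖((sectorSubMatrix L M β F).transpose * normalCovariance L M sym * sectorSubMatrix L M β F) X Y‖ ≤ α)
    {δ : ℝ} (hδ : 0 ≤ δ)
    (hent : ∀ X Y, ‖((sectorSubMatrix L M β F).transpose * normalCovariance L M sym * sectorSubMatrix L M β F) X Y‖ ≤ δ)
    {Na Nb : ℝ} (hNb0 : 0 ≤ Nb)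
    (hNa : ∀ p₀ : Fin m₀, ∑ X : Fin (k + 1) → SpaceTimeIdx L M × SectorLeg N,
      ∑ X₀ ∈ univ.filter (fun X₀ : Fin m₀ → SpaceTimeIdx L M × SectorLeg N => X₀ p₀ = z),
        ‖kernel ℂ a (k + 1 + m₀) (Fin.append X X₀)‖ ≤ Na)
    (hNb : ∀ (Y₀ : SpaceTimeIdx L M × SectorLeg N) (τ : Fin k → SectorLeg N), ∑ y : Fin k → SpaceTimeIdx L M,
      ∑ Y₁ : Fin m₁ → SpaceTimeIdx L M × SectorLeg N,
        ‖kernel ℂ b (k + 1 + m₁) (Fin.append (Fin.cons Y₀ (fun i => (y i, τ i)) : Fin (k + 1) → SpaceTimeIdx L M × SectorLeg N) Y₁)‖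
          ≤ Nb) :
    ∑ Z ∈ univ.filter (fun Z : Fin m → SpaceTimeIdx L M × SectorLeg N => Z p = z),
        ‖kernel ℂ (((grassmannLaplacian ℂ (crossCov ℂ
            ((sectorSubMatrix L M β F).transpose * normalCovariance L M sym * sectorSubMatrix L M β F))) ^ (k + 1))
          (dblCopy ℂ 0 a * dblCopy ℂ 1 b)) m (fun i => (Z i, s i))‖ ≤
      (((k + 1 + m₀).factorial * (k + 1 + m₁).factorial : ℝ) / m.factorial) * (α * (δ * ((4 * ρ₀ : ℕ) : ℝ)) ^ k * Na * Nb) := by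
  have h := sum_norm_kernel_crossContract_pullback_le β F hρ₀ (fun _ : Fin (k + 1) => sym) a b s hm₀ hm₁ p hp z hrow hcol
    (fun _ => δ) (fun _ => hδ) (fun _ => hent) hNb0 hNa hNb
  rw [prod_const, card_univ, Fintype.card_fin] at h
  rwa [crossLaplacian_pow_eq_listProd]

/-- **One symbol on all lines, pinned at a free leg of `b`.** -/
theorem sum_norm_kernel_crossLaplacian_pow_pullback_le_of_eq_one {k m m₀ m₁ : ℕ} (β : ℝ) (F : Fin N → FreqMomentum L M → ℂ)
    {ρ₀ : ℕ} (hρ₀ : ∀ ω : Fin N, ((univ : Finset (Fin N)).filter fun ω' => ∃ q, F ω q * F ω' q ≠ 0).card ≤ ρ₀)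
    (sym : FreqMomentum L M × Fin 2 → ℂ)
    (a b : GrassmannAlgebra ℂ (SpaceTimeIdx L M × SectorLeg N)) (s : Fin m → Fin 2)
    (hm₀ : (univ.filter fun i => s i = 0).card = m₀) (hm₁ : (univ.filter fun i => s i = 1).card = m₁) (p : Fin m) (hp : s p = 1)
    (z : SpaceTimeIdx L M × SectorLeg N) {α : ℝ}
    (hrow : ∀ X, ∑ Y, ‖((sectorSubMatrix L M β F).transpose * normalCovariance L M sym * sectorSubMatrix L M β F) X Y‖ ≤ α)
    (hcol : ∀ Y, ∑ X, ‖((sectorSubMatrix L M β F).transpose * normalCovariance L M sym * sectorSubMatrix L M β F) X Y‖ ≤ α)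
    {δ : ℝ} (hδ : 0 ≤ δ)
    (hent : ∀ X Y, ‖((sectorSubMatrix L M β F).transpose * normalCovariance L M sym * sectorSubMatrix L M β F) X Y‖ ≤ δ)
    {Na Nb : ℝ} (hNa0 : 0 ≤ Na)
    (hNa : ∀ (X₀ : SpaceTimeIdx L M × SectorLeg N) (σ : Fin k → SectorLeg N), ∑ x : Fin k → SpaceTimeIdx L M,
      ∑ Z₀ : Fin m₀ → SpaceTimeIdx L M × SectorLeg N,
        ‖kernel ℂ a (k + 1 + m₀) (Fin.append (Fin.cons X₀ (fun i => (x i, σ i)) : Fin (k + 1) → SpaceTimeIdx L M × SectorLeg N) Z₀)‖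
          ≤ Na)
    (hNb : ∀ p₁ : Fin m₁, ∑ Y : Fin (k + 1) → SpaceTimeIdx L M × SectorLeg N,
      ∑ Y₁ ∈ univ.filter (fun Y₁ : Fin m₁ → SpaceTimeIdx L M × SectorLeg N => Y₁ p₁ = z),
        ‖kernel ℂ b (k + 1 + m₁) (Fin.append Y Y₁)‖ ≤ Nb) :
    ∑ Z ∈ univ.filter (fun Z : Fin m → SpaceTimeIdx L M × SectorLeg N => Z p = z),
        ‖kernel ℂ (((grassmannLaplacian ℂ (crossCov ℂ
            ((sectorSubMatrix L M β F).transpose * normalCovariance L M sym * sectorSubMatrix L M β F))) ^ (k + 1))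
          (dblCopy ℂ 0 a * dblCopy ℂ 1 b)) m (fun i => (Z i, s i))‖ ≤
      (((k + 1 + m₀).factorial * (k + 1 + m₁).factorial : ℝ) / m.factorial) * (α * (δ * ((4 * ρ₀ : ℕ) : ℝ)) ^ k * Na * Nb) := by
  have h := sum_norm_kernel_crossContract_pullback_le_of_eq_one β F hρ₀ (fun _ : Fin (k + 1) => sym) a b s hm₀ hm₁ p hp z hrow hcol
    (fun _ => δ) (fun _ => hδ) (fun _ => hent) hNa0 hNa hNb
  rw [prod_const, card_univ, Fintype.card_fin] at h
  rwa [crossLaplacian_pow_eq_listProd]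

end Sector

/-! ## The instance keyed on `klAnisoFamily` (k3c1-p1 g6, 06:50:11Z: the (E1-v4)/(E1-F) carriers live in that family)

The thin anisotropic family at scale `n` meets at most `9` of its own sectors (`…FrameSectorOverlap.card_overlap_klAnisoFamily_coarse_le` at
`n = n′`), so `ρ₀ = 9` and every extra line costs `δ·36` sector-leg partners. -/

section Aniso

open Summit.HubbardSuperconductivity.HubbardSuperconductivity.Theorems.KLProgrammeLegKernels
open Summit.HubbardSuperconductivity.HubbardSuperconductivity.Theorems.PerturbedFermiCurve

variable {L M : ℕ} [NeZero L] {e₀ : ℝ} (he : 0 < e₀) (β μ : ℝ) (K : TrigPolyC4v) (n : ℕ)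
include he

/-- **Overlap count of `klAnisoFamily … n` with itself** in the product form used above: at most `9` partners. -/
theorem card_overlap_klAnisoFamily_mul_le_nine (ω : Fin (sectorCount n)) :
    ((univ : Finset (Fin (sectorCount n))).filter fun ω' =>
      ∃ q : FreqMomentum L M, klAnisoFamily L M β μ K e₀ n ω q * klAnisoFamily L M β μ K e₀ n ω' q ≠ 0).card ≤ 9 := by
  classical
  refine le_trans (Finset.card_le_card fun ω' hω' => ?_) (card_overlap_klAnisoFamily_coarse_le L M he β μ K le_rfl ω)
  simp only [Finset.mem_filter, Finset.mem_univ, true_and] at hω' ⊢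
  obtain ⟨q, hq⟩ := hω'
  exact ⟨q, (mul_ne_zero_iff.1 hq).1, (mul_ne_zero_iff.1 hq).2⟩

/-- **The `k + 1`-line two-vertex term on `klAnisoFamily … n` sector fields, pinned at a free leg of `a`**: symbols `p_0, …, p_k` (line `0`:
row/column sums `≤ α`; lines `i ≥ 1`: entries `≤ δ_i`) ⇒ `… ≤ ((k+1+m₀)!(k+1+m₁)!/m!) · (α · ∏_i (δ_i · 36) · Na · Nb)`. -/
theorem sum_norm_kernel_crossContract_klAniso_le {k m m₀ m₁ : ℕ} (sym : Fin (k + 1) → FreqMomentum L M × Fin 2 → ℂ)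
    (a b : GrassmannAlgebra ℂ (SpaceTimeIdx L M × SectorLeg (sectorCount n))) (s : Fin m → Fin 2)
    (hm₀ : (univ.filter fun i => s i = 0).card = m₀) (hm₁ : (univ.filter fun i => s i = 1).card = m₁) (p : Fin m) (hp : s p = 0)
    (z : SpaceTimeIdx L M × SectorLeg (sectorCount n)) {α : ℝ}
    (hrow : ∀ X, ∑ Y, ‖((sectorSubMatrix L M β (klAnisoFamily L M β μ K e₀ n)).transpose * normalCovariance L M (sym 0) *
      sectorSubMatrix L M β (klAnisoFamily L M β μ K e₀ n)) X Y‖ ≤ α)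
    (hcol : ∀ Y, ∑ X, ‖((sectorSubMatrix L M β (klAnisoFamily L M β μ K e₀ n)).transpose * normalCovariance L M (sym 0) *
      sectorSubMatrix L M β (klAnisoFamily L M β μ K e₀ n)) X Y‖ ≤ α)
    (δ : Fin k → ℝ) (hδ : ∀ i, 0 ≤ δ i)
    (hent : ∀ (i : Fin k) X Y, ‖((sectorSubMatrix L M β (klAnisoFamily L M β μ K e₀ n)).transpose * normalCovariance L M (sym i.succ) *
      sectorSubMatrix L M β (klAnisoFamily L M β μ K e₀ n)) X Y‖ ≤ δ i)
    {Na Nb : ℝ} (hNb0 : 0 ≤ Nb)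
    (hNa : ∀ p₀ : Fin m₀, ∑ X : Fin (k + 1) → SpaceTimeIdx L M × SectorLeg (sectorCount n),
      ∑ X₀ ∈ univ.filter (fun X₀ : Fin m₀ → SpaceTimeIdx L M × SectorLeg (sectorCount n) => X₀ p₀ = z),
        ‖kernel ℂ a (k + 1 + m₀) (Fin.append X X₀)‖ ≤ Na)
    (hNb : ∀ (Y₀ : SpaceTimeIdx L M × SectorLeg (sectorCount n)) (τ : Fin k → SectorLeg (sectorCount n)),
      ∑ y : Fin k → SpaceTimeIdx L M, ∑ Y₁ : Fin m₁ → SpaceTimeIdx L M × SectorLeg (sectorCount n),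
        ‖kernel ℂ b (k + 1 + m₁) (Fin.append
          (Fin.cons Y₀ (fun i => (y i, τ i)) : Fin (k + 1) → SpaceTimeIdx L M × SectorLeg (sectorCount n)) Y₁)‖ ≤ Nb) :
    ∑ Z ∈ univ.filter (fun Z : Fin m → SpaceTimeIdx L M × SectorLeg (sectorCount n) => Z p = z),
        ‖kernel ℂ (((List.ofFn fun i => grassmannLaplacian ℂ (crossCov ℂ
            ((sectorSubMatrix L M β (klAnisoFamily L M β μ K e₀ n)).transpose * normalCovariance L M (sym i) *
              sectorSubMatrix L M β (klAnisoFamily L M β μ K e₀ n)))).reverse).prod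
          (dblCopy ℂ 0 a * dblCopy ℂ 1 b)) m (fun i => (Z i, s i))‖ ≤
      (((k + 1 + m₀).factorial * (k + 1 + m₁).factorial : ℝ) / m.factorial) * (α * (∏ i, δ i * 36) * Na * Nb) := by
  have h := sum_norm_kernel_crossContract_pullback_le β (klAnisoFamily L M β μ K e₀ n)
    (card_overlap_klAnisoFamily_mul_le_nine he β μ K n) sym a b s hm₀ hm₁ p hp z hrow hcol δ hδ hent hNb0 hNa hNb
  have e : (∏ i, δ i * ((4 * 9 : ℕ) : ℝ)) = ∏ i, δ i * 36 := prod_congr rfl fun i _ => by push_cast; norm_num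
  rwa [e] at h

/-- **The same, pinned at a free leg of `b`.** -/
theorem sum_norm_kernel_crossContract_klAniso_le_of_eq_one {k m m₀ m₁ : ℕ} (sym : Fin (k + 1) → FreqMomentum L M × Fin 2 → ℂ)
    (a b : GrassmannAlgebra ℂ (SpaceTimeIdx L M × SectorLeg (sectorCount n))) (s : Fin m → Fin 2)
    (hm₀ : (univ.filter fun i => s i = 0).card = m₀) (hm₁ : (univ.filter fun i => s i = 1).card = m₁) (p : Fin m) (hp : s p = 1)
    (z : SpaceTimeIdx L M × SectorLeg (sectorCount n)) {α : ℝ}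
    (hrow : ∀ X, ∑ Y, ‖((sectorSubMatrix L M β (klAnisoFamily L M β μ K e₀ n)).transpose * normalCovariance L M (sym 0) *
      sectorSubMatrix L M β (klAnisoFamily L M β μ K e₀ n)) X Y‖ ≤ α)
    (hcol : ∀ Y, ∑ X, ‖((sectorSubMatrix L M β (klAnisoFamily L M β μ K e₀ n)).transpose * normalCovariance L M (sym 0) *
      sectorSubMatrix L M β (klAnisoFamily L M β μ K e₀ n)) X Y‖ ≤ α)
    (δ : Fin k → ℝ) (hδ : ∀ i, 0 ≤ δ i)
    (hent : ∀ (i : Fin k) X Y, ‖((sectorSubMatrix L M β (klAnisoFamily L M β μ K e₀ n)).transpose * normalCovariance L M (sym i.succ) *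
      sectorSubMatrix L M β (klAnisoFamily L M β μ K e₀ n)) X Y‖ ≤ δ i)
    {Na Nb : ℝ} (hNa0 : 0 ≤ Na)
    (hNa : ∀ (X₀ : SpaceTimeIdx L M × SectorLeg (sectorCount n)) (σ : Fin k → SectorLeg (sectorCount n)),
      ∑ x : Fin k → SpaceTimeIdx L M, ∑ Z₀ : Fin m₀ → SpaceTimeIdx L M × SectorLeg (sectorCount n),
        ‖kernel ℂ a (k + 1 + m₀) (Fin.append
          (Fin.cons X₀ (fun i => (x i, σ i)) : Fin (k + 1) → SpaceTimeIdx L M × SectorLeg (sectorCount n)) Z₀)‖ ≤ Na)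
    (hNb : ∀ p₁ : Fin m₁, ∑ Y : Fin (k + 1) → SpaceTimeIdx L M × SectorLeg (sectorCount n),
      ∑ Y₁ ∈ univ.filter (fun Y₁ : Fin m₁ → SpaceTimeIdx L M × SectorLeg (sectorCount n) => Y₁ p₁ = z),
        ‖kernel ℂ b (k + 1 + m₁) (Fin.append Y Y₁)‖ ≤ Nb) :
    ∑ Z ∈ univ.filter (fun Z : Fin m → SpaceTimeIdx L M × SectorLeg (sectorCount n) => Z p = z),
        ‖kernel ℂ (((List.ofFn fun i => grassmannLaplacian ℂ (crossCov ℂ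
            ((sectorSubMatrix L M β (klAnisoFamily L M β μ K e₀ n)).transpose * normalCovariance L M (sym i) *
              sectorSubMatrix L M β (klAnisoFamily L M β μ K e₀ n)))).reverse).prod
          (dblCopy ℂ 0 a * dblCopy ℂ 1 b)) m (fun i => (Z i, s i))‖ ≤
      (((k + 1 + m₀).factorial * (k + 1 + m₁).factorial : ℝ) / m.factorial) * (α * (∏ i, δ i * 36) * Na * Nb) := by
  have h := sum_norm_kernel_crossContract_pullback_le_of_eq_one β (klAnisoFamily L M β μ K e₀ n)
    (card_overlap_klAnisoFamily_mul_le_nine he β μ K n) sym a b s hm₀ hm₁ p hp z hrow hcol δ hδ hent hNa0 hNa hNb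
  have e : (∏ i, δ i * ((4 * 9 : ℕ) : ℝ)) = ∏ i, δ i * 36 := prod_congr rfl fun i _ => by push_cast; norm_num
  rwa [e] at h

/-- **One symbol on all lines, `klAnisoFamily … n`, pinned at a free leg of `a`**:
`… ≤ ((k+1+m₀)!(k+1+m₁)!/m!) · (α · (36δ)^k · Na · Nb)`. -/
theorem sum_norm_kernel_crossLaplacian_pow_klAniso_le {k m m₀ m₁ : ℕ} (sym : FreqMomentum L M × Fin 2 → ℂ)
    (a b : GrassmannAlgebra ℂ (SpaceTimeIdx L M × SectorLeg (sectorCount n))) (s : Fin m → Fin 2)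
    (hm₀ : (univ.filter fun i => s i = 0).card = m₀) (hm₁ : (univ.filter fun i => s i = 1).card = m₁) (p : Fin m) (hp : s p = 0)
    (z : SpaceTimeIdx L M × SectorLeg (sectorCount n)) {α : ℝ}
    (hrow : ∀ X, ∑ Y, ‖((sectorSubMatrix L M β (klAnisoFamily L M β μ K e₀ n)).transpose * normalCovariance L M sym *
      sectorSubMatrix L M β (klAnisoFamily L M β μ K e₀ n)) X Y‖ ≤ α)
    (hcol : ∀ Y, ∑ X, ‖((sectorSubMatrix L M β (klAnisoFamily L M β μ K e₀ n)).transpose * normalCovariance L M sym *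
      sectorSubMatrix L M β (klAnisoFamily L M β μ K e₀ n)) X Y‖ ≤ α)
    {δ : ℝ} (hδ : 0 ≤ δ)
    (hent : ∀ X Y, ‖((sectorSubMatrix L M β (klAnisoFamily L M β μ K e₀ n)).transpose * normalCovariance L M sym *
      sectorSubMatrix L M β (klAnisoFamily L M β μ K e₀ n)) X Y‖ ≤ δ)
    {Na Nb : ℝ} (hNb0 : 0 ≤ Nb)
    (hNa : ∀ p₀ : Fin m₀, ∑ X : Fin (k + 1) → SpaceTimeIdx L M × SectorLeg (sectorCount n),
      ∑ X₀ ∈ univ.filter (fun X₀ : Fin m₀ → SpaceTimeIdx L M × SectorLeg (sectorCount n) => X₀ p₀ = z),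
        ‖kernel ℂ a (k + 1 + m₀) (Fin.append X X₀)‖ ≤ Na)
    (hNb : ∀ (Y₀ : SpaceTimeIdx L M × SectorLeg (sectorCount n)) (τ : Fin k → SectorLeg (sectorCount n)),
      ∑ y : Fin k → SpaceTimeIdx L M, ∑ Y₁ : Fin m₁ → SpaceTimeIdx L M × SectorLeg (sectorCount n),
        ‖kernel ℂ b (k + 1 + m₁) (Fin.append
          (Fin.cons Y₀ (fun i => (y i, τ i)) : Fin (k + 1) → SpaceTimeIdx L M × SectorLeg (sectorCount n)) Y₁)‖ ≤ Nb) :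
    ∑ Z ∈ univ.filter (fun Z : Fin m → SpaceTimeIdx L M × SectorLeg (sectorCount n) => Z p = z),
        ‖kernel ℂ (((grassmannLaplacian ℂ (crossCov ℂ
            ((sectorSubMatrix L M β (klAnisoFamily L M β μ K e₀ n)).transpose * normalCovariance L M sym *
              sectorSubMatrix L M β (klAnisoFamily L M β μ K e₀ n)))) ^ (k + 1))
          (dblCopy ℂ 0 a * dblCopy ℂ 1 b)) m (fun i => (Z i, s i))‖ ≤
      (((k + 1 + m₀).factorial * (k + 1 + m₁).factorial : ℝ) / m.factorial) * (α * (36 * δ) ^ k * Na * Nb) := by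
  have h := sum_norm_kernel_crossLaplacian_pow_pullback_le β (klAnisoFamily L M β μ K e₀ n)
    (card_overlap_klAnisoFamily_mul_le_nine he β μ K n) sym a b s hm₀ hm₁ p hp z hrow hcol hδ hent hNb0 hNa hNb
  have e : δ * ((4 * 9 : ℕ) : ℝ) = 36 * δ := by push_cast; ring
  rwa [e] at h

/-- **One symbol on all lines, `klAnisoFamily … n`, pinned at a free leg of `b`.** -/
theorem sum_norm_kernel_crossLaplacian_pow_klAniso_le_of_eq_one {k m m₀ m₁ : ℕ} (sym : FreqMomentum L M × Fin 2 → ℂ)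
    (a b : GrassmannAlgebra ℂ (SpaceTimeIdx L M × SectorLeg (sectorCount n))) (s : Fin m → Fin 2)
    (hm₀ : (univ.filter fun i => s i = 0).card = m₀) (hm₁ : (univ.filter fun i => s i = 1).card = m₁) (p : Fin m) (hp : s p = 1)
    (z : SpaceTimeIdx L M × SectorLeg (sectorCount n)) {α : ℝ}
    (hrow : ∀ X, ∑ Y, ‖((sectorSubMatrix L M β (klAnisoFamily L M β μ K e₀ n)).transpose * normalCovariance L M sym *
      sectorSubMatrix L M β (klAnisoFamily L M β μ K e₀ n)) X Y‖ ≤ α)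
    (hcol : ∀ Y, ∑ X, ‖((sectorSubMatrix L M β (klAnisoFamily L M β μ K e₀ n)).transpose * normalCovariance L M sym *
      sectorSubMatrix L M β (klAnisoFamily L M β μ K e₀ n)) X Y‖ ≤ α)
    {δ : ℝ} (hδ : 0 ≤ δ)
    (hent : ∀ X Y, ‖((sectorSubMatrix L M β (klAnisoFamily L M β μ K e₀ n)).transpose * normalCovariance L M sym *
      sectorSubMatrix L M β (klAnisoFamily L M β μ K e₀ n)) X Y‖ ≤ δ)
    {Na Nb : ℝ} (hNa0 : 0 ≤ Na)
    (hNa : ∀ (X₀ : SpaceTimeIdx L M × SectorLeg (sectorCount n)) (σ : Fin k → SectorLeg (sectorCount n)),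
      ∑ x : Fin k → SpaceTimeIdx L M, ∑ Z₀ : Fin m₀ → SpaceTimeIdx L M × SectorLeg (sectorCount n),
        ‖kernel ℂ a (k + 1 + m₀) (Fin.append
          (Fin.cons X₀ (fun i => (x i, σ i)) : Fin (k + 1) → SpaceTimeIdx L M × SectorLeg (sectorCount n)) Z₀)‖ ≤ Na)
    (hNb : ∀ p₁ : Fin m₁, ∑ Y : Fin (k + 1) → SpaceTimeIdx L M × SectorLeg (sectorCount n),
      ∑ Y₁ ∈ univ.filter (fun Y₁ : Fin m₁ → SpaceTimeIdx L M × SectorLeg (sectorCount n) => Y₁ p₁ = z),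
        ‖kernel ℂ b (k + 1 + m₁) (Fin.append Y Y₁)‖ ≤ Nb) :
    ∑ Z ∈ univ.filter (fun Z : Fin m → SpaceTimeIdx L M × SectorLeg (sectorCount n) => Z p = z),
        ‖kernel ℂ (((grassmannLaplacian ℂ (crossCov ℂ
            ((sectorSubMatrix L M β (klAnisoFamily L M β μ K e₀ n)).transpose * normalCovariance L M sym *
              sectorSubMatrix L M β (klAnisoFamily L M β μ K e₀ n)))) ^ (k + 1))
          (dblCopy ℂ 0 a * dblCopy ℂ 1 b)) m (fun i => (Z i, s i))‖ ≤
      (((k + 1 + m₀).factorial * (k + 1 + m₁).factorial : ℝ) / m.factorial) * (α * (36 * δ) ^ k * Na * Nb) := by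
  have h := sum_norm_kernel_crossLaplacian_pow_pullback_le_of_eq_one β (klAnisoFamily L M β μ K e₀ n)
    (card_overlap_klAnisoFamily_mul_le_nine he β μ K n) sym a b s hm₀ hm₁ p hp z hrow hcol hδ hent hNa0 hNa hNb
  have e : δ * ((4 * 9 : ℕ) : ℝ) = 36 * δ := by push_cast; ring
  rwa [e] at h

end Aniso

end Summit.HubbardSuperconductivity.HubbardSuperconductivity.Theorems.KLRegimeWick
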